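import Summits.PneNP.PneNP.Theorems.ExpanderLinearGeneratorsNoPolyBoundedProofSystemLadder
import Summits.PneNP.PneNP.Theorems.ExpanderLinearGeneratorsNoPolyBoundedProofSystemQuarterPad
import Summits.PneNP.PneNP.Theorems.ExpanderLinearGeneratorsNoPolyBoundedProofSystemBootstrap
import Literature.Computability.Complexity.EquivalenceProblemsPHProofs
import Literature.Computability.Complexity.StringEquality
import Literature.Computability.Complexity.PRelHierarchy

/-!
# Crux `ProofcplxThesis` / `NoPolyBoundedProofSystem` (stmt-PneNP-0097), line `Sketch`: the open
# stub `conditionalGenerator_of_hardLanguage` is exactly "hard language ⇒ X"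

Analysis file of the line lead (bootstrap composition, `Cruxes/ProofcplxThesis/Lines/Sketch.lean`).
The one open registered stub of the skeleton reads

  `conditionalGenerator_of_hardLanguage : ∀ L ∈ NE ∩ coNE, 2^{δn}-hard a.e. →
     ∃ g, (∀ x, |g x| = |x| + 1) ∧ range g ∈ NP ∧ ¬ HasPolyBoundedProofSystem (range g)ᶜ`.

Because `g` carries no complexity constraint, its CONCLUSION is equivalent to the crux `X` itself:

* `noPolyBoundedProofSystem_of_exists_stretching` — (⇒) `range g ∈ NP` puts `(range g)ᶜ` in
  `coNP`; if `X` failed, `NP = coNP` and Cook–Reckhow's general theorem would give `(range g)ᶜ` a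
  polynomially bounded proof system;
* `exists_stretching_of_noPolyBoundedProofSystem` — (⇐) from `X`, i.e. some `L ∈ NP ∖ coNP`, the
  (non-uniform, classical) map `g(∅) = 0`, `g(1v) = 11v` if `v ∈ L`, `g(bv) = 0^{|v|+2}` otherwise,
  stretches by one bit, has range `{11v | v ∈ L} ∪ {0^m | m ≥ 1} ∈ NP`, and a polynomially bounded
  proof system for the complement of its range would put `L` in `coNP` (preimage under `v ↦ 11v`);
* `exists_stretching_iff_noPolyBoundedProofSystem` — the equivalence, and
* `conditionalGenerator_iff_hard_imp` — hence the registered stub, read as one closed statement, is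
  logically THE implication "(∃ a `2^{δn}`-hard language in `NE ∩ coNE`) → X": the line's residue is
  `X` under an (unproved, believed) exponential circuit lower bound for `NE ∩ coNE` — crux-sized.

Sources: S. A. Cook, R. A. Reckhow, JSL 44 (1979), Prop. 1.1, 1.4; J. Krajíček, Fund. Math. 182
(2004), §4 (the conditional generator statement `R`); A. A. Razborov, Annals of Math. 181 (2015),
§1 (Conjecture 2, pseudorandom generators hard for proof systems).
-/

set_option linter.dupNamespace false -- `Summit.PneNP.PneNP.…`: summit = sub-problem name (D-0017 single-conjunct layout)

namespace Summit.PneNP.PneNP.Theorems.Bootstrap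

open Filter
open Literature.Computability.Complexity Literature.Computability.MetaComplexity
open Summit.PneNP.PneNP.Theses

/-! ### Small closure facts -/

/-- `NP` is closed under intersection with a `P` language (check the `P` condition on the input
component of the witness pair). [cite: AroraBarakCC2009, Thm. 2.8] -/
theorem inter_mem_NP_of_mem_P {A L : Language Bool} (hA : A ∈ Classes.P)
    (hL : L ∈ Nondeterministic.NP) : A ⊓ L ∈ Nondeterministic.NP := by
  obtain ⟨V, hV, q, hq⟩ := hL
  refine ⟨((fun z => (boolUnpair z).1) ⁻¹' A) ⊓ V,
    inter_mem_P (preimage_mem_P hA boolUnpairFst_mem_FP) hV, q, fun x => ?_⟩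
  change x ∈ A ∧ x ∈ L ↔ ∃ y, y.length ≤ q.eval x.length ∧
    (boolPair x y ∈ (fun z => (boolUnpair z).1) ⁻¹' A ∧ boolPair x y ∈ V)
  simp only [Set.mem_preimage, boolUnpair_boolPair, hq]
  constructor
  · rintro ⟨hxA, y, hy, hyV⟩
    exact ⟨y, hy, hxA, hyV⟩
  · rintro ⟨y, hy, hxA, hyV⟩
    exact ⟨hxA, y, hy, hyV⟩

/-- The map `v ↦ 1 1 v` is polynomial-time. [folklore] -/
theorem consTT_mem_FP : (fun v : List Bool => true :: true :: v) ∈ FP :=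
  comp_mem_FP (cons_mem_FP true) (cons_mem_FP true)

/-! ### The conclusion of the stub implies the crux -/

/-- If some one-bit-stretching map has `NP` range whose complement has no polynomially bounded proof
system, then `X` (`NoPolyBoundedProofSystem`): otherwise `NP = coNP`, `(range g)ᶜ ∈ coNP = NP`, and
Cook–Reckhow's general theorem gives a polynomially bounded proof system. [cite: CookReckhow1979, §1 Prop. 1.4] -/
theorem noPolyBoundedProofSystem_of_exists_stretching
    (h : ∃ g : List Bool → List Bool, (∀ x, (g x).length = x.length + 1) ∧
      Set.range g ∈ Nondeterministic.NP ∧ ¬ HasPolyBoundedProofSystem (Set.range g)ᶜ) :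
    ExpanderLinearGenerators.NoPolyBoundedProofSystem := by
  rw [noPolyBoundedProofSystem_iff_NP_ne_coNP]
  intro hNC
  obtain ⟨g, -, hR, hng⟩ := h
  have hco : Set.range g ∈ coNP := hNC ▸ hR
  have hCR := @hasPolyBoundedProofSystem_iff_mem_NP_holds (Set.range g)ᶜ
  unfold hasPolyBoundedProofSystem_iff_mem_NP at hCR
  exact hng (hCR.2 hco)

/-! ### The crux implies the conclusion of the stub -/

/-- From `X` — i.e. some `L ∈ NP ∖ coNP` — a one-bit-stretching map with `NP` range whose range
complement has no polynomially bounded proof system: `g(∅) = 0`, `g(1v) = 11v` for `v ∈ L`,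
`g(bv) = 0^{|v|+2}` otherwise (classical, no uniformity claimed). [cite: CookReckhow1979, §1 Prop. 1.4] -/
theorem exists_stretching_of_noPolyBoundedProofSystem
    (hX : ExpanderLinearGenerators.NoPolyBoundedProofSystem) :
    ∃ g : List Bool → List Bool, (∀ x, (g x).length = x.length + 1) ∧
      Set.range g ∈ Nondeterministic.NP ∧ ¬ HasPolyBoundedProofSystem (Set.range g)ᶜ := by
  classical
  obtain ⟨L, hL, hLco⟩ := noPolyBoundedProofSystem_iff_exists_mem_NP_not_mem_coNP.1 hX
  -- the two halves of the range
  set T : Language Bool := {w | ∃ v ∈ L, w = true :: true :: v} with hTdef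
  set Z : Language Bool := {w | w ≠ [] ∧ w = List.replicate w.length false} with hZdef
  -- the map
  let g : List Bool → List Bool := fun x =>
    match x with
    | [] => [false]
    | b :: v => if b = true ∧ v ∈ L then true :: true :: v else List.replicate (v.length + 2) false
  have hg_nil : g [] = [false] := rfl
  have hg_cons : ∀ b v, g (b :: v) =
      (if b = true ∧ v ∈ L then true :: true :: v else List.replicate (v.length + 2) false) :=
    fun _ _ => rfl
  refine ⟨g, ?_, ?_, ?_⟩
  · -- stretching by one bit
    intro x
    cases x with
    | nil => rfl
    | cons b v =>
      rw [hg_cons]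
      split_ifs <;> simp
  · -- the range is `T ∪ Z`, an `NP` language
    have hrange : Set.range g = T ⊔ Z := by
      ext w
      constructor
      · rintro ⟨x, rfl⟩
        cases x with
        | nil => exact Or.inr ⟨by simp [hg_nil], by simp [hg_nil]⟩
        | cons b v =>
          rw [hg_cons]
          split_ifs with hc
          · exact Or.inl ⟨v, hc.2, rfl⟩
          · exact Or.inr ⟨by simp, by simp⟩
      · rintro (⟨v, hv, rfl⟩ | ⟨hne, hw⟩)
        · exact ⟨true :: v, by rw [hg_cons, if_pos ⟨rfl, hv⟩]⟩
        · obtain _ | ⟨b, u⟩ := w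
          · exact absurd rfl hne
          · cases u with
            | nil =>
              refine ⟨[], ?_⟩
              rw [hg_nil, hw]
              simp
            | cons c u' =>
              refine ⟨false :: u', ?_⟩
              rw [hg_cons, if_neg (by simp), hw]
              simp
    rw [hrange]
    -- `T = A ⊓ f⁻¹(L)` with `f = tail ∘ tail`, `A = {w | w = 11 f(w)}`
    have hT : T = ({w | (fun z : List Bool => z) w =
        ((fun v : List Bool => true :: true :: v) ∘ (List.tail ∘ List.tail)) w} : Language Bool) ⊓
        ((List.tail ∘ List.tail) ⁻¹' L) := by
      ext w
      constructor
      · rintro ⟨v, hv, rfl⟩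
        exact ⟨rfl, hv⟩
      · rintro ⟨hw, hv⟩
        exact ⟨w.tail.tail, hv, hw⟩
    have hTNP : T ∈ Nondeterministic.NP := by
      rw [hT]
      refine inter_mem_NP_of_mem_P ?_ (preimage_mem_NP hL (comp_mem_FP PRelSigma.tail_mem_FP PRelSigma.tail_mem_FP))
      exact setOf_apply_eq_apply_mem_P (PolyTimeComputable.id _) (comp_mem_FP consTT_mem_FP
        (comp_mem_FP PRelSigma.tail_mem_FP PRelSigma.tail_mem_FP))
    -- `Z` is in `P`
    have hZ : Z = ({w | ¬ (fun z : List Bool => z) w = (fun _ : List Bool => ([] : List Bool)) w} :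
        Language Bool) ⊓ {w | (fun z : List Bool => z) w = Kannan.zerosFn w} := by
      ext w
      simp only [hZdef, Kannan.zerosFn_apply]
      rfl
    have hZP : Z ∈ Classes.P := by
      rw [hZ]
      exact inter_mem_P (Kannan.setOf_not_mem_P (setOf_apply_eq_apply_mem_P (PolyTimeComputable.id _)
        (const_mem_FP _))) (setOf_apply_eq_apply_mem_P (PolyTimeComputable.id _) Kannan.zerosFn_mem_FP)
    exact CFKer.union_mem_NP hTNP (P_subset_NP_holds hZP)
  · -- no polynomially bounded proof system for the complement of the range
    intro hP
    have hCR := @hasPolyBoundedProofSystem_iff_mem_NP_holds (Set.range g)ᶜ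
    unfold hasPolyBoundedProofSystem_iff_mem_NP at hCR
    have hNP : (Set.range g)ᶜ ∈ Nondeterministic.NP := hCR.1 hP
    have hpre := preimage_mem_NP hNP consTT_mem_FP
    apply hLco
    change Lᶜ ∈ Nondeterministic.NP
    -- the preimage of `(range g)ᶜ` under `v ↦ 11v` is `Lᶜ`
    have hset : (fun v : List Bool => true :: true :: v) ⁻¹' (Set.range g)ᶜ = Lᶜ := by
      ext v
      change (true :: true :: v ∉ Set.range g) ↔ v ∉ L
      rw [not_iff_not]
      constructor
      · rintro ⟨x, hx⟩
        cases x with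
        | nil =>
          rw [hg_nil] at hx
          simp at hx
        | cons b u =>
          rw [hg_cons] at hx
          split_ifs at hx with hc
          · simp only [List.cons.injEq, true_and] at hx
            exact hx ▸ hc.2
          · simp [List.replicate_succ] at hx
      · intro hv
        exact ⟨true :: v, by rw [hg_cons, if_pos ⟨rfl, hv⟩]⟩
    rw [hset] at hpre
    exact hpre

/-! ### The equivalence and the reading of the stub -/

/-- **The conclusion of the open stub is equivalent to the crux.** [cite: CookReckhow1979, §1 Prop. 1.4] -/
theorem exists_stretching_iff_noPolyBoundedProofSystem :
    (∃ g : List Bool → List Bool, (∀ x, (g x).length = x.length + 1) ∧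
      Set.range g ∈ Nondeterministic.NP ∧ ¬ HasPolyBoundedProofSystem (Set.range g)ᶜ) ↔
    ExpanderLinearGenerators.NoPolyBoundedProofSystem :=
  ⟨noPolyBoundedProofSystem_of_exists_stretching, exists_stretching_of_noPolyBoundedProofSystem⟩

/-- **Reading of the registered stub `conditionalGenerator_of_hardLanguage`.** As one closed
statement it is equivalent to "if some language in `NE ∩ coNE` has circuit complexity `≥ 2^{δn}`
for all large `n` (some `δ > 0`), then `X`". [cite: CookReckhow1979, §1 Prop. 1.4] -/
theorem conditionalGenerator_iff_hard_imp :
    (∀ L : Language Bool, L ∈ NE → Lᶜ ∈ NE → ∀ δ : ℝ, 0 < δ →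
      (∀ᶠ n : ℕ in atTop, (2 : ℝ) ^ (δ * n) ≤ (L.circuitSize n : ℝ)) →
      ∃ g : List Bool → List Bool, (∀ x, (g x).length = x.length + 1) ∧
        Set.range g ∈ Nondeterministic.NP ∧ ¬ HasPolyBoundedProofSystem (Set.range g)ᶜ) ↔
    ((∃ L : Language Bool, L ∈ NE ∧ Lᶜ ∈ NE ∧ ∃ δ : ℝ, 0 < δ ∧
      ∀ᶠ n : ℕ in atTop, (2 : ℝ) ^ (δ * n) ≤ (L.circuitSize n : ℝ)) →
      ExpanderLinearGenerators.NoPolyBoundedProofSystem) := by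
  constructor
  · rintro h ⟨L, hL, hLc, δ, hδ, hhard⟩
    exact noPolyBoundedProofSystem_of_exists_stretching (h L hL hLc δ hδ hhard)
  · intro h L hL hLc δ hδ hhard
    exact exists_stretching_of_noPolyBoundedProofSystem (h ⟨L, hL, hLc, δ, hδ, hhard⟩)

/-! ### The stub is the crux (appended 2026-08-17, after the bootstrap landed) -/

/-- **The open stub IS the crux.** With the bootstrap PROVED in the tree
(`hardLanguageInNEcoNE_of_not_noPolyBoundedProofSystem`: if `X` fails, a `2^{n/8}`-hard language lies
in `NE ∩ coNE`), the registered stub `conditionalGenerator_of_hardLanguage`, read as one closed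
statement, is logically EQUIVALENT to `X` itself: by `conditionalGenerator_iff_hard_imp` it is
"hard language ⇒ X", and its hypothesis holds whenever `X` fails. So the bootstrap line relocates `X`
without weakening it (line census, `Cruxes/ProofcplxThesis/Lines/Sketch.dead.md`).
[cite: CookReckhow1979, §1 Prop. 1.4] -/
theorem conditionalGenerator_iff_noPolyBoundedProofSystem :
    (∀ L : Language Bool, L ∈ NE → Lᶜ ∈ NE → ∀ δ : ℝ, 0 < δ →
      (∀ᶠ n : ℕ in atTop, (2 : ℝ) ^ (δ * n) ≤ (L.circuitSize n : ℝ)) →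
      ∃ g : List Bool → List Bool, (∀ x, (g x).length = x.length + 1) ∧
        Set.range g ∈ Nondeterministic.NP ∧ ¬ HasPolyBoundedProofSystem (Set.range g)ᶜ) ↔
    ExpanderLinearGenerators.NoPolyBoundedProofSystem := by
  rw [conditionalGenerator_iff_hard_imp]
  constructor
  · intro h
    by_contra hX
    exact hX (h (hardLanguageInNEcoNE_of_not_noPolyBoundedProofSystem hX))
  · exact fun hX _ => hX

/-- Equivalently: the hypothesis "some `2^{δn}`-hard language in `NE ∩ coNE`" is IDLE against `X` —
`X` holds iff (`X` holds or the hypothesis fails), because the hypothesis is a CONSEQUENCE of `¬X`.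
[cite: Kannan1982, Lemma 1] -/
theorem noPolyBoundedProofSystem_or_not_hard_iff :
    (ExpanderLinearGenerators.NoPolyBoundedProofSystem ∨
      ¬ ∃ L : Language Bool, L ∈ NE ∧ Lᶜ ∈ NE ∧ ∃ δ : ℝ, 0 < δ ∧
        ∀ᶠ n : ℕ in atTop, (2 : ℝ) ^ (δ * n) ≤ (L.circuitSize n : ℝ)) ↔
    ExpanderLinearGenerators.NoPolyBoundedProofSystem := by
  constructor
  · rintro (hX | hnot)
    · exact hX
    · by_contra hX
      exact hnot (hardLanguageInNEcoNE_of_not_noPolyBoundedProofSystem hX)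
  · exact Or.inl

end Summit.PneNP.PneNP.Theorems.Bootstrap
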